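import Summits.HodgeConjecture.HodgeConjecture.Theorems.Ring2WeilCoverageCMFieldIrrationalRows
import Summits.HodgeConjecture.HodgeConjecture.Theorems.Ring2WeilCoverageCMFieldBiquadratic
import HarnessLib

/-!
# Weil-type components over quartic CM fields with NO RATIONAL DISCRIMINANT, III: the rows of the
# biquadratic census fields `ℚ(ζ₈) = ℚ(i,√2)` and `ℚ(ζ₁₂) = ℚ(i,√3)`

research route conditional on HC_CM; not a corollary; Q11.4-sentence-2 already refuted in dim ≥ 3.
Cell `pub-hodge-ring2`, seat `ring2-b03` (gen 57); kernel certificates for the Weil-type family-coverage census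
`HOME/WEIL-FAMILY-COVERAGE.md` §b03.5 (operator priority5 2026-08-22T11:46:08Z). Companion of
`Ring2WeilCoverageCMFieldNormParity.lean` (engine) and `Ring2WeilCoverageCMFieldIrrationalRows.lean` (certificate
`mk_ne_mk_ratCast_of_normParity`: `[u + vσ] ≠ [c]` in `F^×/Nm_{E/F}(E^×)` for EVERY `c ∈ ℚ^×` when
`N_{F/ℚ}(u + vσ)` has odd valuation at a prime `ℓ` all of whose places in `F` are inert in `E/F`). Here: the
`(field, ℓ)`-level theorems and ALL rows inside `S6` of §b03.5 with a tabulated representative and «least rational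
n: –» (`|T| = 2` and `|T| = 4`) for `ℚ(ζ₈)` (`R = S² + 6S + 1`, `σ = η² = −(1+√2)²`; `ℓ = 7, 23, 31 ≡ 7 (mod 8)`:
split in `F = ℚ(√2)`, both places inert in `F(i)`; 16 rows) and `ℚ(ζ₁₂)` (`R = S² + 8S + 4`, `σ = −(1+√3)²`;
`ℓ = 3` — the prime `(√3)` of `F = ℚ(√3)`, RAMIFIED in `F` and INERT in `E = F(i)`: a regular double root
`σ ≡ 2 (mod 3)`, `9 ∤ R(2) = 24` — and `ℓ = 11, 23`; 18 rows). Row representatives are the least representatives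
`δ = u₀ + v₀√d` of §b03.5 written on `{1, σ}` by the table's own `σ` (`√2 = −(σ+3)/2`, `√3 = −(σ+4)/2`), so `4δ ∈ ℤ[σ]`
is used where `δ ∉ ℤ[σ]`; `[m²δ] = [δ]` since `m² = Nm_{E/F}(m)` (`mk_mul_sq_cmNormResidueGroup`). The `√5`-fields
`ℚ(√-3,√5)`, `ℚ(i,√5)` are in `…IrrationalRowsBiquadraticSqrtFive.lean`.

No named fact, no definition, no `sorry`; nothing about the Hodge conjecture is asserted.
References: [Deligne1982HodgeCycles] §4 p. 30 (1), Cor. 4.2, Lemma 4.6; [Landherr1936HermitianForms]. -/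

noncomputable section

set_option linter.dupNamespace false

open Polynomial

namespace Summit.HodgeConjecture.HodgeConjecture.Ring2.WeilCoverageCM

open Literature.AlgebraicGeometry.Deligne1982
open Literature.AlgebraicGeometry.HodgeTheory (splitDiscriminantClassCM)

/-! ### `E = ℚ(ζ₈) = ℚ(i,√2)`: `R = S² + 6S + 1` -/

/-- **ℚ(ζ₈) = ℚ(i,√2), `ℓ = 7`** (two roots `σ ≡ 3, 5 (mod 7)`, non-squares: every place of `F` over `7` is
inert in `E/F`): every `δ = u + vσ ∈ ℤ[σ]` with `N_{F/ℚ}(δ) = u² - 6uv + 1v² = 7·w`, `7 ∤ w`, has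
`[δ] ≠ [c]` in `F^×/Nm_{E/F}(E^×)` for EVERY `c ∈ ℚ^×`. [cite: Deligne1982HodgeCycles, §4 p. 30 (1) and Cor. 4.2] -/
theorem zeta8_mk_ne_mk_ratCast_of_norm_seven {R : Polynomial ℤ} (hR : R = X ^ 2 + C 6 * X + C 1)
    [Fact (Irreducible (realPolyQ R))] (u v w : ℤ) (hw : ¬ (7 : ℤ) ∣ w)
    (hN : u ^ 2 - 6 * u * v + 1 * v ^ 2 = 7 * w) (δ : (realField R)ˣ)
    (hδ : (δ : realField R) = AdjoinRoot.of (realPolyQ R) u + AdjoinRoot.of (realPolyQ R) v * AdjoinRoot.root (realPolyQ R))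
    (c : ℚ) (γ : (realField R)ˣ) (hγ : (γ : realField R) = (c : realField R)) :
    (QuotientGroup.mk δ : cmNormResidueGroup R) ≠ QuotientGroup.mk γ := by
  haveI : Fact (Irreducible (cmPolyQ R)) := fact_irreducible_cmPolyQ_of_pos hR (by norm_num) (by norm_num) disc_not_sq_six_one
  exact mk_ne_mk_ratCast_of_normParity hR 7 (by norm_num) 3 5 (by norm_num) (by norm_num) (by decide) (by decide)
    (by norm_num) (by norm_num) u v 0 w (by exact_mod_cast hw) (by rw [hN]; push_cast; ring) δ hδ c γ hγ

/-- **ℚ(ζ₈) = ℚ(i,√2), `ℓ = 23`** (two roots `σ ≡ 7, 10 (mod 23)`, non-squares: every place of `F` over `23` is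
inert in `E/F`): every `δ = u + vσ ∈ ℤ[σ]` with `N_{F/ℚ}(δ) = u² - 6uv + 1v² = 23·w`, `23 ∤ w`, has
`[δ] ≠ [c]` in `F^×/Nm_{E/F}(E^×)` for EVERY `c ∈ ℚ^×`. [cite: Deligne1982HodgeCycles, §4 p. 30 (1) and Cor. 4.2] -/
theorem zeta8_mk_ne_mk_ratCast_of_norm_twentyThree {R : Polynomial ℤ} (hR : R = X ^ 2 + C 6 * X + C 1)
    [Fact (Irreducible (realPolyQ R))] (u v w : ℤ) (hw : ¬ (23 : ℤ) ∣ w)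
    (hN : u ^ 2 - 6 * u * v + 1 * v ^ 2 = 23 * w) (δ : (realField R)ˣ)
    (hδ : (δ : realField R) = AdjoinRoot.of (realPolyQ R) u + AdjoinRoot.of (realPolyQ R) v * AdjoinRoot.root (realPolyQ R))
    (c : ℚ) (γ : (realField R)ˣ) (hγ : (γ : realField R) = (c : realField R)) :
    (QuotientGroup.mk δ : cmNormResidueGroup R) ≠ QuotientGroup.mk γ := by
  haveI : Fact (Irreducible (cmPolyQ R)) := fact_irreducible_cmPolyQ_of_pos hR (by norm_num) (by norm_num) disc_not_sq_six_one
  exact mk_ne_mk_ratCast_of_normParity hR 23 (by norm_num) 7 10 (by norm_num) (by norm_num) (by decide) (by decide)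
    (by norm_num) (by norm_num) u v 0 w (by exact_mod_cast hw) (by rw [hN]; push_cast; ring) δ hδ c γ hγ

/-- **ℚ(ζ₈) = ℚ(i,√2), `ℓ = 31`** (two roots `σ ≡ 12, 13 (mod 31)`, non-squares: every place of `F` over `31` is
inert in `E/F`): every `δ = u + vσ ∈ ℤ[σ]` with `N_{F/ℚ}(δ) = u² - 6uv + 1v² = 31·w`, `31 ∤ w`, has
`[δ] ≠ [c]` in `F^×/Nm_{E/F}(E^×)` for EVERY `c ∈ ℚ^×`. [cite: Deligne1982HodgeCycles, §4 p. 30 (1) and Cor. 4.2] -/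
theorem zeta8_mk_ne_mk_ratCast_of_norm_thirtyOne {R : Polynomial ℤ} (hR : R = X ^ 2 + C 6 * X + C 1)
    [Fact (Irreducible (realPolyQ R))] (u v w : ℤ) (hw : ¬ (31 : ℤ) ∣ w)
    (hN : u ^ 2 - 6 * u * v + 1 * v ^ 2 = 31 * w) (δ : (realField R)ˣ)
    (hδ : (δ : realField R) = AdjoinRoot.of (realPolyQ R) u + AdjoinRoot.of (realPolyQ R) v * AdjoinRoot.root (realPolyQ R))
    (c : ℚ) (γ : (realField R)ˣ) (hγ : (γ : realField R) = (c : realField R)) :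
    (QuotientGroup.mk δ : cmNormResidueGroup R) ≠ QuotientGroup.mk γ := by
  haveI : Fact (Irreducible (cmPolyQ R)) := fact_irreducible_cmPolyQ_of_pos hR (by norm_num) (by norm_num) disc_not_sq_six_one
  exact mk_ne_mk_ratCast_of_normParity hR 31 (by norm_num) 12 13 (by norm_num) (by norm_num) (by decide) (by decide)
    (by norm_num) (by norm_num) u v 0 w (by exact_mod_cast hw) (by rw [hN]; push_cast; ring) δ hδ c γ hγ

/-- **ℚ(ζ₈) = ℚ(i,√2): rows of §b03.5 with NO RATIONAL REPRESENTATIVE, in the kernel** — for `R = X ^ 2 + C 6 * X + C 1` LITERALLY and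
each listed `(u, v)` (convention `√2 = −(σ + 3)/2, i.e. σ = −(1+√2)² (4δ where δ ∉ ℤ[σ])`; `(u,v)` = least representative `δ` of the row `T` of §b03.5 on `{1, σ}`
— times the square shown, if `δ ∉ ℤ[σ]` —, with its norm `N_{F/ℚ}`:
  `(18,2)` = 4·(3−√2) {1,2}, N 112;
  `(6,-2)` = 4·(3+√2) {1,3}, N 112;
  `(26,2)` = 4·(5−√2) {1,4}, N 368;
  `(14,-2)` = 4·(5+√2) {1,5}, N 368;
  `(10,-6)` = 4·(7+3√2) {1,6}, N 496;
  `(29,4)` = 17−8√2 {2,4}, N 161;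
  `(16,1)` = 13−2√2 {2,5}, N 161;
  `(12,-1)` = 15+2√2 {2,6}, N 217;
  `(10,-1)` = 13+2√2 {3,4}, N 161;
  `(5,-4)` = 17+8√2 {3,5}, N 161;
  `(26,3)` = 17−6√2 {3,6}, N 217;
  `(17,-4)` = 29+8√2 {4,6}, N 713;
  `(59,8)` = 35−16√2 {5,6}, N 713;
  `(182,14)` = 4·(35−7√2) {1,2,3,4}, N 18032;
  `(98,-14)` = 4·(35+7√2) {1,2,3,5}, N 18032;
  `(70,-42)` = 4·(49+21√2) {1,2,3,6}, N 24304):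
the class `[u + vσ]` differs from `[c]` for EVERY `c ∈ ℚ^×` — the component `W8.E.[u + vσ]` is none of the
integer-indexed rows `[n]` and not the split row. [cite: Deligne1982HodgeCycles, §4 p. 30 (1) and Cor. 4.2] -/
theorem zeta8_irrational_rows :
    haveI := fact_irreducible_realPolyQ_of_not_sq (R := X ^ 2 + C 6 * X + C 1) rfl disc_not_sq_six_one
    ∀ uv ∈ [((18 : ℤ), (2 : ℤ)), (6, -2), (26, 2), (14, -2), (10, -6), (29, 4), (16, 1), (12, -1), (10, -1), (5, -4), (26, 3), (17, -4), (59, 8), (182, 14), (98, -14), (70, -42)],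
      ∀ δ : (realField (X ^ 2 + C 6 * X + C 1))ˣ,
        (δ : realField (X ^ 2 + C 6 * X + C 1)) = AdjoinRoot.of (realPolyQ (X ^ 2 + C 6 * X + C 1)) (uv.1 : ℚ)
            + AdjoinRoot.of (realPolyQ (X ^ 2 + C 6 * X + C 1)) (uv.2 : ℚ) * AdjoinRoot.root (realPolyQ (X ^ 2 + C 6 * X + C 1)) →
        ∀ (c : ℚ) (γ : (realField (X ^ 2 + C 6 * X + C 1))ˣ), (γ : realField (X ^ 2 + C 6 * X + C 1)) = (c : realField (X ^ 2 + C 6 * X + C 1)) →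
          (QuotientGroup.mk δ : cmNormResidueGroup (X ^ 2 + C 6 * X + C 1)) ≠ QuotientGroup.mk γ := by
  haveI := fact_irreducible_realPolyQ_of_not_sq (R := X ^ 2 + C 6 * X + C 1) rfl disc_not_sq_six_one
  intro uv huv δ hδ c γ hγ
  obtain ⟨u, v⟩ := uv
  simp only [List.mem_cons, Prod.mk.injEq, List.not_mem_nil, or_false] at huv
  rcases huv with ⟨rfl, rfl⟩ | ⟨rfl, rfl⟩ | ⟨rfl, rfl⟩ | ⟨rfl, rfl⟩ | ⟨rfl, rfl⟩ | ⟨rfl, rfl⟩ | ⟨rfl, rfl⟩ | ⟨rfl, rfl⟩ | ⟨rfl, rfl⟩ | ⟨rfl, rfl⟩ | ⟨rfl, rfl⟩ | ⟨rfl, rfl⟩ | ⟨rfl, rfl⟩ | ⟨rfl, rfl⟩ | ⟨rfl, rfl⟩ | ⟨rfl, rfl⟩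
  · exact zeta8_mk_ne_mk_ratCast_of_norm_seven rfl 18 (2) (16) (by norm_num) (by norm_num) δ hδ c γ hγ
  · exact zeta8_mk_ne_mk_ratCast_of_norm_seven rfl 6 (-2) (16) (by norm_num) (by norm_num) δ hδ c γ hγ
  · exact zeta8_mk_ne_mk_ratCast_of_norm_twentyThree rfl 26 (2) (16) (by norm_num) (by norm_num) δ hδ c γ hγ
  · exact zeta8_mk_ne_mk_ratCast_of_norm_twentyThree rfl 14 (-2) (16) (by norm_num) (by norm_num) δ hδ c γ hγ
  · exact zeta8_mk_ne_mk_ratCast_of_norm_thirtyOne rfl 10 (-6) (16) (by norm_num) (by norm_num) δ hδ c γ hγ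
  · exact zeta8_mk_ne_mk_ratCast_of_norm_seven rfl 29 (4) (23) (by norm_num) (by norm_num) δ hδ c γ hγ
  · exact zeta8_mk_ne_mk_ratCast_of_norm_seven rfl 16 (1) (23) (by norm_num) (by norm_num) δ hδ c γ hγ
  · exact zeta8_mk_ne_mk_ratCast_of_norm_seven rfl 12 (-1) (31) (by norm_num) (by norm_num) δ hδ c γ hγ
  · exact zeta8_mk_ne_mk_ratCast_of_norm_seven rfl 10 (-1) (23) (by norm_num) (by norm_num) δ hδ c γ hγ
  · exact zeta8_mk_ne_mk_ratCast_of_norm_seven rfl 5 (-4) (23) (by norm_num) (by norm_num) δ hδ c γ hγ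
  · exact zeta8_mk_ne_mk_ratCast_of_norm_seven rfl 26 (3) (31) (by norm_num) (by norm_num) δ hδ c γ hγ
  · exact zeta8_mk_ne_mk_ratCast_of_norm_twentyThree rfl 17 (-4) (31) (by norm_num) (by norm_num) δ hδ c γ hγ
  · exact zeta8_mk_ne_mk_ratCast_of_norm_twentyThree rfl 59 (8) (31) (by norm_num) (by norm_num) δ hδ c γ hγ
  · exact zeta8_mk_ne_mk_ratCast_of_norm_twentyThree rfl 182 (14) (784) (by norm_num) (by norm_num) δ hδ c γ hγ
  · exact zeta8_mk_ne_mk_ratCast_of_norm_twentyThree rfl 98 (-14) (784) (by norm_num) (by norm_num) δ hδ c γ hγ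
  · exact zeta8_mk_ne_mk_ratCast_of_norm_thirtyOne rfl 70 (-42) (784) (by norm_num) (by norm_num) δ hδ c γ hγ

/-! ### `E = ℚ(ζ₁₂) = ℚ(i,√3)`: `R = S² + 8S + 4` -/

/-- **ℚ(ζ₁₂) = ℚ(i,√3), `ℓ = 3`** (double root `σ ≡ 2, 2 (mod 3)`, non-squares: every place of `F` over `3` is
inert in `E/F`): every `δ = u + vσ ∈ ℤ[σ]` with `N_{F/ℚ}(δ) = u² - 8uv + 4v² = 3·w`, `3 ∤ w`, has
`[δ] ≠ [c]` in `F^×/Nm_{E/F}(E^×)` for EVERY `c ∈ ℚ^×`. [cite: Deligne1982HodgeCycles, §4 p. 30 (1) and Cor. 4.2] -/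
theorem zeta12_mk_ne_mk_ratCast_of_norm_three {R : Polynomial ℤ} (hR : R = X ^ 2 + C 8 * X + C 4)
    [Fact (Irreducible (realPolyQ R))] (u v w : ℤ) (hw : ¬ (3 : ℤ) ∣ w)
    (hN : u ^ 2 - 8 * u * v + 4 * v ^ 2 = 3 * w) (δ : (realField R)ˣ)
    (hδ : (δ : realField R) = AdjoinRoot.of (realPolyQ R) u + AdjoinRoot.of (realPolyQ R) v * AdjoinRoot.root (realPolyQ R))
    (c : ℚ) (γ : (realField R)ˣ) (hγ : (γ : realField R) = (c : realField R)) :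
    (QuotientGroup.mk δ : cmNormResidueGroup R) ≠ QuotientGroup.mk γ := by
  haveI : Fact (Irreducible (cmPolyQ R)) := fact_irreducible_cmPolyQ_of_pos hR (by norm_num) (by norm_num) disc_not_sq_eight_four
  exact mk_ne_mk_ratCast_of_normParity hR 3 (by norm_num) 2 2 (by norm_num) (by norm_num) (by decide) (by decide)
    (by norm_num) (by norm_num) u v 0 w (by exact_mod_cast hw) (by rw [hN]; push_cast; ring) δ hδ c γ hγ

/-- **ℚ(ζ₁₂) = ℚ(i,√3), `ℓ = 11`** (two roots `σ ≡ 6, 8 (mod 11)`, non-squares: every place of `F` over `11` is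
inert in `E/F`): every `δ = u + vσ ∈ ℤ[σ]` with `N_{F/ℚ}(δ) = u² - 8uv + 4v² = 11·w`, `11 ∤ w`, has
`[δ] ≠ [c]` in `F^×/Nm_{E/F}(E^×)` for EVERY `c ∈ ℚ^×`. [cite: Deligne1982HodgeCycles, §4 p. 30 (1) and Cor. 4.2] -/
theorem zeta12_mk_ne_mk_ratCast_of_norm_eleven {R : Polynomial ℤ} (hR : R = X ^ 2 + C 8 * X + C 4)
    [Fact (Irreducible (realPolyQ R))] (u v w : ℤ) (hw : ¬ (11 : ℤ) ∣ w)
    (hN : u ^ 2 - 8 * u * v + 4 * v ^ 2 = 11 * w) (δ : (realField R)ˣ)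
    (hδ : (δ : realField R) = AdjoinRoot.of (realPolyQ R) u + AdjoinRoot.of (realPolyQ R) v * AdjoinRoot.root (realPolyQ R))
    (c : ℚ) (γ : (realField R)ˣ) (hγ : (γ : realField R) = (c : realField R)) :
    (QuotientGroup.mk δ : cmNormResidueGroup R) ≠ QuotientGroup.mk γ := by
  haveI : Fact (Irreducible (cmPolyQ R)) := fact_irreducible_cmPolyQ_of_pos hR (by norm_num) (by norm_num) disc_not_sq_eight_four
  exact mk_ne_mk_ratCast_of_normParity hR 11 (by norm_num) 6 8 (by norm_num) (by norm_num) (by decide) (by decide)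
    (by norm_num) (by norm_num) u v 0 w (by exact_mod_cast hw) (by rw [hN]; push_cast; ring) δ hδ c γ hγ

/-- **ℚ(ζ₁₂) = ℚ(i,√3), `ℓ = 23`** (two roots `σ ≡ 5, 10 (mod 23)`, non-squares: every place of `F` over `23` is
inert in `E/F`): every `δ = u + vσ ∈ ℤ[σ]` with `N_{F/ℚ}(δ) = u² - 8uv + 4v² = 23·w`, `23 ∤ w`, has
`[δ] ≠ [c]` in `F^×/Nm_{E/F}(E^×)` for EVERY `c ∈ ℚ^×`. [cite: Deligne1982HodgeCycles, §4 p. 30 (1) and Cor. 4.2] -/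
theorem zeta12_mk_ne_mk_ratCast_of_norm_twentyThree {R : Polynomial ℤ} (hR : R = X ^ 2 + C 8 * X + C 4)
    [Fact (Irreducible (realPolyQ R))] (u v w : ℤ) (hw : ¬ (23 : ℤ) ∣ w)
    (hN : u ^ 2 - 8 * u * v + 4 * v ^ 2 = 23 * w) (δ : (realField R)ˣ)
    (hδ : (δ : realField R) = AdjoinRoot.of (realPolyQ R) u + AdjoinRoot.of (realPolyQ R) v * AdjoinRoot.root (realPolyQ R))
    (c : ℚ) (γ : (realField R)ˣ) (hγ : (γ : realField R) = (c : realField R)) :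
    (QuotientGroup.mk δ : cmNormResidueGroup R) ≠ QuotientGroup.mk γ := by
  haveI : Fact (Irreducible (cmPolyQ R)) := fact_irreducible_cmPolyQ_of_pos hR (by norm_num) (by norm_num) disc_not_sq_eight_four
  exact mk_ne_mk_ratCast_of_normParity hR 23 (by norm_num) 5 10 (by norm_num) (by norm_num) (by decide) (by decide)
    (by norm_num) (by norm_num) u v 0 w (by exact_mod_cast hw) (by rw [hN]; push_cast; ring) δ hδ c γ hγ

/-- **ℚ(ζ₁₂) = ℚ(i,√3): rows of §b03.5 with NO RATIONAL REPRESENTATIVE, in the kernel** — for `R = X ^ 2 + C 8 * X + C 4` LITERALLY and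
each listed `(u, v)` (convention `√3 = −(σ + 4)/2, i.e. σ = −(1+√3)² (4δ where δ ∉ ℤ[σ])`; `(u,v)` = least representative `δ` of the row `T` of §b03.5 on `{1, σ}`
— times the square shown, if `δ ∉ ℤ[σ]` —, with its norm `N_{F/ℚ}`:
  `(4,-2)` = 4·(3+√3) {1,2}, N 96;
  `(28,2)` = 4·(5−√3) {1,3}, N 352;
  `(12,-2)` = 4·(5+√3) {1,4}, N 352;
  `(36,2)` = 4·(7−√3) {1,5}, N 736;
  `(20,-2)` = 4·(7+√3) {1,6}, N 736;
  `(16,-2)` = 4·(6+√3) {2,3}, N 528;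
  `(32,2)` = 4·(6−√3) {2,4}, N 528;
  `(5,-1)` = 9+2√3 {2,5}, N 69;
  `(13,1)` = 9−2√3 {2,6}, N 69;
  `(31,3)` = 19−6√3 {3,5}, N 253;
  `(72,2)` = 4·(16−√3) {3,6}, N 4048;
  `(56,-2)` = 4·(16+√3) {4,5}, N 4048;
  `(7,-3)` = 19+6√3 {4,6}, N 253;
  `(44,-22)` = 4·(33+11√3) {1,2,3,4}, N 11616;
  `(148,-2)` = 4·(39+√3) {1,2,3,5}, N 24288;
  `(76,-26)` = 4·(45+13√3) {1,2,3,6}, N 24288;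
  `(284,26)` = 4·(45−13√3) {1,2,4,5}, N 24288;
  `(164,2)` = 4·(39−√3) {1,2,4,6}, N 24288):
the class `[u + vσ]` differs from `[c]` for EVERY `c ∈ ℚ^×` — the component `W8.E.[u + vσ]` is none of the
integer-indexed rows `[n]` and not the split row. [cite: Deligne1982HodgeCycles, §4 p. 30 (1) and Cor. 4.2] -/
theorem zeta12_irrational_rows :
    haveI := fact_irreducible_realPolyQ_of_not_sq (R := X ^ 2 + C 8 * X + C 4) rfl disc_not_sq_eight_four
    ∀ uv ∈ [((4 : ℤ), (-2 : ℤ)), (28, 2), (12, -2), (36, 2), (20, -2), (16, -2), (32, 2), (5, -1), (13, 1), (31, 3), (72, 2), (56, -2), (7, -3), (44, -22), (148, -2), (76, -26), (284, 26), (164, 2)],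
      ∀ δ : (realField (X ^ 2 + C 8 * X + C 4))ˣ,
        (δ : realField (X ^ 2 + C 8 * X + C 4)) = AdjoinRoot.of (realPolyQ (X ^ 2 + C 8 * X + C 4)) (uv.1 : ℚ)
            + AdjoinRoot.of (realPolyQ (X ^ 2 + C 8 * X + C 4)) (uv.2 : ℚ) * AdjoinRoot.root (realPolyQ (X ^ 2 + C 8 * X + C 4)) →
        ∀ (c : ℚ) (γ : (realField (X ^ 2 + C 8 * X + C 4))ˣ), (γ : realField (X ^ 2 + C 8 * X + C 4)) = (c : realField (X ^ 2 + C 8 * X + C 4)) →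
          (QuotientGroup.mk δ : cmNormResidueGroup (X ^ 2 + C 8 * X + C 4)) ≠ QuotientGroup.mk γ := by
  haveI := fact_irreducible_realPolyQ_of_not_sq (R := X ^ 2 + C 8 * X + C 4) rfl disc_not_sq_eight_four
  intro uv huv δ hδ c γ hγ
  obtain ⟨u, v⟩ := uv
  simp only [List.mem_cons, Prod.mk.injEq, List.not_mem_nil, or_false] at huv
  rcases huv with ⟨rfl, rfl⟩ | ⟨rfl, rfl⟩ | ⟨rfl, rfl⟩ | ⟨rfl, rfl⟩ | ⟨rfl, rfl⟩ | ⟨rfl, rfl⟩ | ⟨rfl, rfl⟩ | ⟨rfl, rfl⟩ | ⟨rfl, rfl⟩ | ⟨rfl, rfl⟩ | ⟨rfl, rfl⟩ | ⟨rfl, rfl⟩ | ⟨rfl, rfl⟩ | ⟨rfl, rfl⟩ | ⟨rfl, rfl⟩ | ⟨rfl, rfl⟩ | ⟨rfl, rfl⟩ | ⟨rfl, rfl⟩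
  · exact zeta12_mk_ne_mk_ratCast_of_norm_three rfl 4 (-2) (32) (by norm_num) (by norm_num) δ hδ c γ hγ
  · exact zeta12_mk_ne_mk_ratCast_of_norm_eleven rfl 28 (2) (32) (by norm_num) (by norm_num) δ hδ c γ hγ
  · exact zeta12_mk_ne_mk_ratCast_of_norm_eleven rfl 12 (-2) (32) (by norm_num) (by norm_num) δ hδ c γ hγ
  · exact zeta12_mk_ne_mk_ratCast_of_norm_twentyThree rfl 36 (2) (32) (by norm_num) (by norm_num) δ hδ c γ hγ
  · exact zeta12_mk_ne_mk_ratCast_of_norm_twentyThree rfl 20 (-2) (32) (by norm_num) (by norm_num) δ hδ c γ hγ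
  · exact zeta12_mk_ne_mk_ratCast_of_norm_three rfl 16 (-2) (176) (by norm_num) (by norm_num) δ hδ c γ hγ
  · exact zeta12_mk_ne_mk_ratCast_of_norm_three rfl 32 (2) (176) (by norm_num) (by norm_num) δ hδ c γ hγ
  · exact zeta12_mk_ne_mk_ratCast_of_norm_three rfl 5 (-1) (23) (by norm_num) (by norm_num) δ hδ c γ hγ
  · exact zeta12_mk_ne_mk_ratCast_of_norm_three rfl 13 (1) (23) (by norm_num) (by norm_num) δ hδ c γ hγ
  · exact zeta12_mk_ne_mk_ratCast_of_norm_eleven rfl 31 (3) (23) (by norm_num) (by norm_num) δ hδ c γ hγ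
  · exact zeta12_mk_ne_mk_ratCast_of_norm_eleven rfl 72 (2) (368) (by norm_num) (by norm_num) δ hδ c γ hγ
  · exact zeta12_mk_ne_mk_ratCast_of_norm_eleven rfl 56 (-2) (368) (by norm_num) (by norm_num) δ hδ c γ hγ
  · exact zeta12_mk_ne_mk_ratCast_of_norm_eleven rfl 7 (-3) (23) (by norm_num) (by norm_num) δ hδ c γ hγ
  · exact zeta12_mk_ne_mk_ratCast_of_norm_three rfl 44 (-22) (3872) (by norm_num) (by norm_num) δ hδ c γ hγ
  · exact zeta12_mk_ne_mk_ratCast_of_norm_three rfl 148 (-2) (8096) (by norm_num) (by norm_num) δ hδ c γ hγ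
  · exact zeta12_mk_ne_mk_ratCast_of_norm_three rfl 76 (-26) (8096) (by norm_num) (by norm_num) δ hδ c γ hγ
  · exact zeta12_mk_ne_mk_ratCast_of_norm_three rfl 284 (26) (8096) (by norm_num) (by norm_num) δ hδ c γ hγ
  · exact zeta12_mk_ne_mk_ratCast_of_norm_three rfl 164 (2) (8096) (by norm_num) (by norm_num) δ hδ c γ hγ

end Summit.HodgeConjecture.HodgeConjecture.Ring2.WeilCoverageCM

end
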